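import Summits.HubbardSuperconductivity.HubbardSuperconductivity.Theorems.BalabanIRBirComplexStableXYRLinearBL
import Summits.HubbardSuperconductivity.HubbardSuperconductivity.Theorems.BalabanIRBirComplexStableXYRCorePenalty
import Summits.HubbardSuperconductivity.HubbardSuperconductivity.Theorems.BalabanIRBirComplexStableXYRGaussianCoercive
import Summits.HubbardSuperconductivity.HubbardSuperconductivity.Theorems.BalabanIRBirComplexStableXYRResistance
import Summits.HubbardSuperconductivity.HubbardSuperconductivity.Theorems.BalabanIRBirComplexStableXYFixedVolumeLattice
import HarnessLib

/-!
# Brascamp–Lieb on the log-concave envelope of the modulus weight (torus level)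

Support file for crux `BirComplexStableXYR` (stmt-HubbardSuperconductivity-14845) of route
`BalabanIR`, idea card `log-concave-core-bounded-phase`, step (c) ("the Gaussian-regime half of
conjunct 2 is Brascamp–Lieb, `M`-uniform by Rayleigh monotonicity").

For an admissible table (`(U1)`, `(N)`, `(A) normA ≤ B`, `(C) c₀`), a convexity radius `δ₀` of it
(file `…RConvexityRadius`), the core threshold `2a = δ₀²`, a penalty strength `k` with
`k·6a² ≥ 2max(B,0) + c₀/4`, a stiffness `K > 0` and a torus `(ℤ/L)² × ℤ/M` with `2 ≤ L ≤ M`, the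
LOG-CONCAVE ENVELOPE of the pinned modulus weight,

  `f(v) = K·[Σ_s Re F((ext v)∘sh s) + k·Σ_s p(ΣΣ((ext v)_{sh s w} − (ext v)_{sh s w'})² − a)]`,
  `p(y) = (max y 0)³`, `ext v` = extension by `0` at the pinned site `0`,

coincides with `K·Re A(ext v)` on the core `{∀ s, ΣΣ(…)² ≤ a}`, is `C²`, and its second derivative
along every line dominates `K(c₀/4)·Σ_s ΣΣ((ext η)_{sh s w} − (ext η)_{sh s w'})²` (`core_floor`),
a positive definite form whose "resistance" between two slice sites is `≤ 256/(Kc₀)`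
(`core_sigma`, from `gcoer_window_ge_unitSteps` + `res_resistance_bound_zmod`).  Brascamp–Lieb for
linear observables (`LinearBL.linearBL`) then gives the ENVELOPE VARIANCE BOUND
(`coreEnvelope_variance`): `Var_{e^{-f}}((ext v)(x,0) − (ext v)(y,0)) ≤ 256/(K c₀)`, uniformly in
`2 ≤ L ≤ M`, for every `k` as above.  The hard-core limit `k → ∞` is taken in the sequel.

No new definitions; fully proved, standard axioms.
-/

noncomputable section

namespace Summit.HubbardSuperconductivity.HubbardSuperconductivity.Theorems

namespace CoreBL

open scoped BigOperators Topology
open MeasureTheory Filter Summit.HubbardSuperconductivity.BirComplexStableXYNegative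
open Literature.Probability.LatticeModels CorePenalty

variable {r : ℕ} {L M : ℕ} [NeZero L] [NeZero M]

/-! ### The pinned extension -/

omit [NeZero L] [NeZero M] in
/-- The pinned extension is linear along lines: `ext(x + tη) = ext x + t·ext η` pointwise. [folklore] -/
theorem ext_line (x η : {i : Λ L M // i ≠ 0} → ℝ) (t : ℝ) (i : Λ L M) :
    (fun i => if h : i = (0 : Λ L M) then (0 : ℝ) else (x + t • η) ⟨i, h⟩) i =
      (fun i => if h : i = (0 : Λ L M) then (0 : ℝ) else x ⟨i, h⟩) i +
        t * (fun i => if h : i = (0 : Λ L M) then (0 : ℝ) else η ⟨i, h⟩) i := by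
  by_cases h : i = 0
  · simp [h]
  · simp [h]

/-- Each coordinate of the pinned extension is a smooth (linear) function of `v`. [folklore] -/
theorem contDiff_ext_apply (i : Λ L M) {n : WithTop ℕ∞} :
    ContDiff ℝ n (fun v : {i : Λ L M // i ≠ 0} → ℝ =>
      (fun j => if h : j = (0 : Λ L M) then (0 : ℝ) else v ⟨j, h⟩) i) := by
  by_cases h : i = 0
  · simp only [h, dite_true]; exact contDiff_const
  · simp only [h, dite_false]; exact contDiff_apply ℝ ℝ (⟨i, h⟩ : {i : Λ L M // i ≠ 0})

/-! ### Smoothness of the envelope -/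

/-- `Re F` of a smooth family of window coordinates is smooth. [folklore] -/
theorem contDiff_re_genF {V : Type*} [NormedAddCommGroup V] [NormedSpace ℝ V] (c : Table r)
    {e : W r → V → ℝ} {n : WithTop ℕ∞} (he : ∀ w, ContDiff ℝ n (e w)) :
    ContDiff ℝ n (fun v : V => (genF c (fun w => e w v)).re) := by
  classical
  have hF : ContDiff ℝ n (fun v : V => genF c (fun w => e w v)) := by
    unfold genF Finsupp.sum
    refine ContDiff.sum fun m _ => contDiff_const.mul ?_
    refine Complex.contDiff_exp.comp (contDiff_const.mul ?_)
    exact Complex.ofRealCLM.contDiff.comp (ContDiff.sum fun w _ => contDiff_const.mul (he w))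
  exact Complex.reCLM.contDiff.comp hF

/-- The window penalty of a smooth family of window coordinates is `C²`. [folklore] -/
theorem contDiff_win_pen {V : Type*} [NormedAddCommGroup V] [NormedSpace ℝ V]
    {e : W r → V → ℝ} (he : ∀ w, ContDiff ℝ 2 (e w)) (a : ℝ) :
    ContDiff ℝ 2 (fun v : V => (max ((∑ w : W r, ∑ w' : W r, (e w v - e w' v) ^ 2) - a) 0) ^ 3) := by
  have hq : ContDiff ℝ 2 (fun v : V => (∑ w : W r, ∑ w' : W r, (e w v - e w' v) ^ 2) - a) :=
    (ContDiff.sum fun w _ => ContDiff.sum fun w' _ => ((he w).sub (he w')).pow 2).sub contDiff_const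
  exact pen_contDiff.comp hq

/-- **The envelope is `C²`.** [folklore] -/
theorem contDiff_envelope (c : Table r) (K k a : ℝ) :
    ContDiff ℝ 2 (fun v : {i : Λ L M // i ≠ 0} → ℝ =>
      K * ((∑ s : Λ L M, (genF c (fun w =>
          (fun j => if h : j = (0 : Λ L M) then (0 : ℝ) else v ⟨j, h⟩) (sh L M s w))).re) +
        k * ∑ s : Λ L M, (max ((∑ w : W r, ∑ w' : W r,
          ((fun j => if h : j = (0 : Λ L M) then (0 : ℝ) else v ⟨j, h⟩) (sh L M s w) -
            (fun j => if h : j = (0 : Λ L M) then (0 : ℝ) else v ⟨j, h⟩) (sh L M s w')) ^ 2) - a) 0) ^ 3)) := by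
  refine contDiff_const.mul ((ContDiff.sum fun s _ => ?_).add (contDiff_const.mul
    (ContDiff.sum fun s _ => ?_)))
  · exact contDiff_re_genF c fun w => contDiff_ext_apply (sh L M s w)
  · exact contDiff_win_pen (fun w => contDiff_ext_apply (sh L M s w)) a

/-! ### Line derivatives of the envelope -/

/-- **First derivative of the envelope along a line** `t ↦ f(x + tη)`. [folklore] -/
theorem envelope_line_hasDerivAt (c : Table r) (K k a : ℝ) (x η : {i : Λ L M // i ≠ 0} → ℝ)
    (t : ℝ) :
    let ext : ({i : Λ L M // i ≠ 0} → ℝ) → Λ L M → ℝ :=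
      fun v i => if h : i = (0 : Λ L M) then (0 : ℝ) else v ⟨i, h⟩
    let f : ({i : Λ L M // i ≠ 0} → ℝ) → ℝ := fun v =>
      K * ((∑ s : Λ L M, (genF c (fun w => ext v (sh L M s w))).re) +
        k * ∑ s : Λ L M, (max ((∑ w : W r, ∑ w' : W r, (ext v (sh L M s w) - ext v (sh L M s w')) ^ 2) - a) 0) ^ 3)
    HasDerivAt (fun s : ℝ => f (x + s • η))
      (K * ((∑ s : Λ L M, (c.sum (fun n b => b * ((∑ w, (n w : ℝ) * ext η (sh L M s w) : ℝ) : ℂ) *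
          Complex.I * Complex.exp (Complex.I *
            ((∑ w, (n w : ℝ) * (ext x (sh L M s w) + t * ext η (sh L M s w)) : ℝ) : ℂ)))).re) +
        k * ∑ s : Λ L M, (3 * (max ((∑ w : W r, ∑ w' : W r,
            ((ext x (sh L M s w) + t * ext η (sh L M s w)) -
              (ext x (sh L M s w') + t * ext η (sh L M s w'))) ^ 2) - a) 0) ^ 2 *
          ∑ w : W r, ∑ w' : W r, 2 * ((ext x (sh L M s w) + t * ext η (sh L M s w)) -
            (ext x (sh L M s w') + t * ext η (sh L M s w'))) * (ext η (sh L M s w) - ext η (sh L M s w'))))) t := by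
  intro ext f
  have hext : ∀ (s : ℝ) (i : Λ L M), ext (x + s • η) i = ext x i + s * ext η i :=
    fun s i => ext_line x η s i
  have hfun : (fun s : ℝ => f (x + s • η)) = fun s : ℝ =>
      K * ((∑ σ : Λ L M, (genF c (fun w => ext x (sh L M σ w) + s * ext η (sh L M σ w))).re) +
        k * ∑ σ : Λ L M, (max ((∑ w : W r, ∑ w' : W r,
          ((ext x (sh L M σ w) + s * ext η (sh L M σ w)) -
            (ext x (sh L M σ w') + s * ext η (sh L M σ w'))) ^ 2) - a) 0) ^ 3) := by
    funext s
    simp only [f, hext]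
  rw [hfun]
  refine HasDerivAt.const_mul K (HasDerivAt.add ?_ (HasDerivAt.const_mul k ?_))
  · exact HasDerivAt.fun_sum fun σ _ =>
      cvxr_hasDerivAt_re_genF_line c (fun w => ext x (sh L M σ w)) (fun w => ext η (sh L M σ w)) t
  · exact HasDerivAt.fun_sum fun σ _ =>
      win_pen_hasDerivAt (fun w => ext x (sh L M σ w)) (fun w => ext η (sh L M σ w)) a t

/-- **Second derivative of the envelope along a line.** [folklore] -/
theorem envelope_dline_hasDerivAt (c : Table r) (K k a : ℝ) (x η : {i : Λ L M // i ≠ 0} → ℝ)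
    (t : ℝ) :
    let ext : ({i : Λ L M // i ≠ 0} → ℝ) → Λ L M → ℝ :=
      fun v i => if h : i = (0 : Λ L M) then (0 : ℝ) else v ⟨i, h⟩
    HasDerivAt (fun t : ℝ =>
      K * ((∑ s : Λ L M, (c.sum (fun n b => b * ((∑ w, (n w : ℝ) * ext η (sh L M s w) : ℝ) : ℂ) *
          Complex.I * Complex.exp (Complex.I *
            ((∑ w, (n w : ℝ) * (ext x (sh L M s w) + t * ext η (sh L M s w)) : ℝ) : ℂ)))).re) +
        k * ∑ s : Λ L M, (3 * (max ((∑ w : W r, ∑ w' : W r,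
            ((ext x (sh L M s w) + t * ext η (sh L M s w)) -
              (ext x (sh L M s w') + t * ext η (sh L M s w'))) ^ 2) - a) 0) ^ 2 *
          ∑ w : W r, ∑ w' : W r, 2 * ((ext x (sh L M s w) + t * ext η (sh L M s w)) -
            (ext x (sh L M s w') + t * ext η (sh L M s w'))) * (ext η (sh L M s w) - ext η (sh L M s w')))))
      (K * ((∑ s : Λ L M, (-c.sum (fun n b => b * (((∑ w, (n w : ℝ) * ext η (sh L M s w)) ^ 2 : ℝ) : ℂ) *
          Complex.exp (Complex.I *
            ((∑ w, (n w : ℝ) * (ext x (sh L M s w) + t * ext η (sh L M s w)) : ℝ) : ℂ)))).re) +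
        k * ∑ s : Λ L M,
          (6 * max ((∑ w : W r, ∑ w' : W r, ((ext x (sh L M s w) + t * ext η (sh L M s w)) -
              (ext x (sh L M s w') + t * ext η (sh L M s w'))) ^ 2) - a) 0 *
            (∑ w : W r, ∑ w' : W r, 2 * ((ext x (sh L M s w) + t * ext η (sh L M s w)) -
              (ext x (sh L M s w') + t * ext η (sh L M s w'))) * (ext η (sh L M s w) - ext η (sh L M s w'))) ^ 2 +
          3 * (max ((∑ w : W r, ∑ w' : W r, ((ext x (sh L M s w) + t * ext η (sh L M s w)) -
              (ext x (sh L M s w') + t * ext η (sh L M s w'))) ^ 2) - a) 0) ^ 2 *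
            ∑ w : W r, ∑ w' : W r, 2 * (ext η (sh L M s w) - ext η (sh L M s w')) ^ 2))) t := by
  intro ext
  refine HasDerivAt.const_mul K (HasDerivAt.add ?_ (HasDerivAt.const_mul k ?_))
  · exact HasDerivAt.fun_sum fun σ _ =>
      cvxr_hasDerivAt_re_dgenF_line c (fun w => ext x (sh L M σ w)) (fun w => ext η (sh L M σ w)) t
  · exact HasDerivAt.fun_sum fun σ _ =>
      win_dpen_hasDerivAt (fun w => ext x (sh L M σ w)) (fun w => ext η (sh L M σ w)) a t

/-! ### The floor, positivity, the minimum and the resistance -/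

/-- **The floor of the envelope's second derivative** at `t = 0`:
`K(c₀/4)·Σ_s ΣΣ((ext η)_{sh s w} − (ext η)_{sh s w'})² ≤ f''`, from `win_floor` window by window.
[folklore] -/
theorem core_floor (c : Table r) (hU1 : ∀ n ∈ c.support, ∑ w, n w = 0) {B c₀ δ₀ a k K : ℝ}
    (hA : normA c ≤ B) (hδ₀ : 0 < δ₀)
    (hconv : ∀ φ : W r → ℝ, (∀ w w', |φ w - φ w'| ≤ δ₀) → ∀ ψ : W r → ℝ,
      c₀ / 4 * ∑ w : W r, ∑ w' : W r, (ψ w - ψ w') ^ 2 ≤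
        (-c.sum (fun n b => b * (((∑ w, (n w : ℝ) * ψ w) ^ 2 : ℝ) : ℂ) *
          Complex.exp (Complex.I * ((∑ w, (n w : ℝ) * φ w : ℝ) : ℂ)))).re)
    (ha : 2 * a = δ₀ ^ 2) (hk0 : 0 ≤ k) (hk : 2 * max B 0 + c₀ / 4 ≤ k * (6 * a ^ 2)) (hK : 0 ≤ K)
    (θ u : Λ L M → ℝ) :
    K * (c₀ / 4) * ∑ s : Λ L M, ∑ w : W r, ∑ w' : W r, (u (sh L M s w) - u (sh L M s w')) ^ 2 ≤
      K * ((∑ s : Λ L M, (-c.sum (fun n b => b * (((∑ w, (n w : ℝ) * u (sh L M s w)) ^ 2 : ℝ) : ℂ) *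
          Complex.exp (Complex.I *
            ((∑ w, (n w : ℝ) * (θ (sh L M s w) + 0 * u (sh L M s w)) : ℝ) : ℂ)))).re) +
        k * ∑ s : Λ L M,
          (6 * max ((∑ w : W r, ∑ w' : W r, ((θ (sh L M s w) + 0 * u (sh L M s w)) -
              (θ (sh L M s w') + 0 * u (sh L M s w'))) ^ 2) - a) 0 *
            (∑ w : W r, ∑ w' : W r, 2 * ((θ (sh L M s w) + 0 * u (sh L M s w)) -
              (θ (sh L M s w') + 0 * u (sh L M s w'))) * (u (sh L M s w) - u (sh L M s w'))) ^ 2 +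
          3 * (max ((∑ w : W r, ∑ w' : W r, ((θ (sh L M s w) + 0 * u (sh L M s w)) -
              (θ (sh L M s w') + 0 * u (sh L M s w'))) ^ 2) - a) 0) ^ 2 *
            ∑ w : W r, ∑ w' : W r, 2 * (u (sh L M s w) - u (sh L M s w')) ^ 2)) := by
  simp only [zero_mul, add_zero]
  rw [Finset.mul_sum, Finset.mul_sum, ← Finset.sum_add_distrib, Finset.mul_sum]
  refine Finset.sum_le_sum fun s _ => ?_
  have h := win_floor c hU1 hA hδ₀ hconv ha hk0 hk (fun w => θ (sh L M s w)) (fun w => u (sh L M s w))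
  have := mul_le_mul_of_nonneg_left h hK
  linarith

/-- **Positivity of the floor form**: if `Σ_s ΣΣ((ext η)_{sh s w} − (ext η)_{sh s w'})² = 0` then
`η = 0` (the three unit steps sit inside every window, `r ≥ 2`; the torus is connected and the
extension is pinned at `0`). [folklore] -/
theorem core_form_pos (hr : 2 ≤ r) (η : {i : Λ L M // i ≠ 0} → ℝ) (hη : η ≠ 0) :
    0 < ∑ s : Λ L M, ∑ w : W r, ∑ w' : W r,
      ((fun i => if h : i = (0 : Λ L M) then (0 : ℝ) else η ⟨i, h⟩) (sh L M s w) -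
        (fun i => if h : i = (0 : Λ L M) then (0 : ℝ) else η ⟨i, h⟩) (sh L M s w')) ^ 2 := by
  set u : Λ L M → ℝ := fun i => if h : i = (0 : Λ L M) then (0 : ℝ) else η ⟨i, h⟩ with hu
  have hnn : 0 ≤ ∑ s : Λ L M, ∑ w : W r, ∑ w' : W r, (u (sh L M s w) - u (sh L M s w')) ^ 2 :=
    Finset.sum_nonneg fun _ _ => Finset.sum_nonneg fun _ _ => Finset.sum_nonneg fun _ _ => sq_nonneg _
  refine lt_of_le_of_ne hnn fun h0 => hη ?_
  have hterms := (Finset.sum_eq_zero_iff_of_nonneg (fun s _ =>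
    Finset.sum_nonneg fun _ _ => Finset.sum_nonneg fun _ _ => sq_nonneg _)).1 h0.symm
  refine birLat_eq_zero_of_diff (0 : Λ L M) η fun s e he => ?_
  have hs := hterms s (Finset.mem_univ s)
  have hwin := gcoer_window_ge_unitSteps hr L M u s
  have h3 : (u s - u (s + (![1, 0], 0))) ^ 2 + (u s - u (s + (![0, 1], 0))) ^ 2 +
      (u s - u (s + (0, 1))) ^ 2 = 0 := le_antisymm (hwin.trans hs.le) (by positivity)
  have h1 : u s - u (s + (![1, 0], 0)) = 0 := by nlinarith
  have h2 : u s - u (s + (![0, 1], 0)) = 0 := by nlinarith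
  have h3' : u s - u (s + (0, 1)) = 0 := by nlinarith
  simp only [Set.mem_insert_iff, Set.mem_singleton_iff] at he
  rcases he with rfl | rfl | rfl
  · exact h1
  · exact h2
  · exact h3'

/-- **The envelope is minimised at the constants**: with (N) and (C), `f(0) = 0 ≤ f(v)`. [folklore] -/
theorem envelope_min (c : Table r) (hN : c.sum (fun _ a => a) = 0) {c₀ : ℝ} (hc₀ : 0 ≤ c₀)
    (hC : ∀ φ : W r → ℝ, c₀ * ∑ w : W r, ∑ w' : W r, (1 - Real.cos (φ w - φ w')) ≤ (genF c φ).re)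
    {K k a : ℝ} (hK : 0 ≤ K) (hk : 0 ≤ k) (ha : 0 ≤ a) (v : {i : Λ L M // i ≠ 0} → ℝ) :
    let ext : ({i : Λ L M // i ≠ 0} → ℝ) → Λ L M → ℝ :=
      fun v i => if h : i = (0 : Λ L M) then (0 : ℝ) else v ⟨i, h⟩
    let f : ({i : Λ L M // i ≠ 0} → ℝ) → ℝ := fun v =>
      K * ((∑ s : Λ L M, (genF c (fun w => ext v (sh L M s w))).re) +
        k * ∑ s : Λ L M, (max ((∑ w : W r, ∑ w' : W r, (ext v (sh L M s w) - ext v (sh L M s w')) ^ 2) - a) 0) ^ 3)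
    f 0 ≤ f v := by
  intro ext f
  have hext0 : ∀ i, ext 0 i = 0 := fun i => by
    simp only [ext]; split_ifs <;> simp
  have hF0 : genF c (fun _ : W r => (0 : ℝ)) = 0 := by
    have : genF c (fun _ : W r => (0 : ℝ)) = c.sum (fun _ a => a) := by
      unfold genF; refine Finsupp.sum_congr fun n _ => ?_; simp
    rw [this, hN]
  have hf0 : f 0 = 0 := by
    simp only [f, hext0, hF0, sub_self, Complex.zero_re, Finset.sum_const_zero]
    simp [pen_eq_zero (show -a ≤ 0 by linarith)]
  rw [hf0]
  have hre : ∀ s : Λ L M, 0 ≤ (genF c (fun w => ext v (sh L M s w))).re := fun s =>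
    le_trans (mul_nonneg hc₀ (Finset.sum_nonneg fun _ _ => Finset.sum_nonneg fun _ _ =>
      sub_nonneg.2 (Real.cos_le_one _))) (hC _)
  have h1 : 0 ≤ ∑ s : Λ L M, (genF c (fun w => ext v (sh L M s w))).re :=
    Finset.sum_nonneg fun s _ => hre s
  have h2 : 0 ≤ ∑ s : Λ L M, (max ((∑ w : W r, ∑ w' : W r,
      (ext v (sh L M s w) - ext v (sh L M s w')) ^ 2) - a) 0) ^ 3 :=
    Finset.sum_nonneg fun s _ => pen_nonneg _
  exact mul_nonneg hK (add_nonneg h1 (mul_nonneg hk h2))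

/-- The slice-difference observable as a dot product on the pinned coordinates. [folklore] -/
theorem slice_obs_eq_dotProduct (x y : TorusSite 2 L) (η : {i : Λ L M // i ≠ 0} → ℝ) :
    (fun i : {i : Λ L M // i ≠ 0} =>
        (if i.1 = ((x, 0) : Λ L M) then (1 : ℝ) else 0) - (if i.1 = ((y, 0) : Λ L M) then (1 : ℝ) else 0)) ⬝ᵥ η =
      (fun i => if h : i = (0 : Λ L M) then (0 : ℝ) else η ⟨i, h⟩) (x, 0) -
        (fun i => if h : i = (0 : Λ L M) then (0 : ℝ) else η ⟨i, h⟩) (y, 0) := by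
  classical
  have key : ∀ p : Λ L M, (∑ i : {i : Λ L M // i ≠ 0}, (if i.1 = p then (1 : ℝ) else 0) * η i) =
      (fun i => if h : i = (0 : Λ L M) then (0 : ℝ) else η ⟨i, h⟩) p := by
    intro p
    by_cases hp : p = 0
    · simp only [hp, dite_true]
      refine Finset.sum_eq_zero fun i _ => ?_
      simp [i.2]
    · simp only [hp, dite_false]
      rw [Finset.sum_eq_single ⟨p, hp⟩]
      · simp
      · intro i _ hi
        have : i.1 ≠ p := fun h => hi (Subtype.ext h)
        simp [this]
      · intro h; exact absurd (Finset.mem_univ _) h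
  simp only [dotProduct, sub_mul, Finset.sum_sub_distrib, key]

/-- **The resistance of the floor form between two slice sites**: for `2 ≤ L ≤ M`, `K, c₀ > 0`,
`2·((ext η)(x,0) − (ext η)(y,0)) − K(c₀/4)·Σ_s ΣΣ(…)² ≤ 256/(K c₀)` (unit steps inside windows +
`res_resistance_bound_zmod` + `2h − αh² ≤ 1/α`). [folklore] -/
theorem core_sigma (hr : 2 ≤ r) {K c₀ : ℝ} (hK : 0 < K) (hc₀ : 0 < c₀) (hL : 2 ≤ L) (hLM : L ≤ M)
    (x y : TorusSite 2 L) (u : Λ L M → ℝ) :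
    2 * (u (x, 0) - u (y, 0)) - K * (c₀ / 4) * ∑ s : Λ L M, ∑ w : W r, ∑ w' : W r,
        (u (sh L M s w) - u (sh L M s w')) ^ 2 ≤ 256 / (K * c₀) := by
  have hres := BirSpinWave.res_resistance_bound_zmod hL hLM u x y 0
  have hwin : ∑ s : Λ L M, ((u s - u (s + (![1, 0], 0))) ^ 2 + (u s - u (s + (![0, 1], 0))) ^ 2 +
      (u s - u (s + (0, 1))) ^ 2) ≤
      ∑ s : Λ L M, ∑ w : W r, ∑ w' : W r, (u (sh L M s w) - u (sh L M s w')) ^ 2 :=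
    Finset.sum_le_sum fun s _ => gcoer_window_ge_unitSteps hr L M u s
  set h := u (x, 0) - u (y, 0) with hh
  set D := ∑ s : Λ L M, ∑ w : W r, ∑ w' : W r, (u (sh L M s w) - u (sh L M s w')) ^ 2 with hD
  have hKc : 0 < K * c₀ := mul_pos hK hc₀
  have h64 : h ^ 2 ≤ 64 * D := hres.trans (by linarith [mul_le_mul_of_nonneg_left hwin (by norm_num : (0:ℝ) ≤ 64)])
  -- `2h − (Kc₀/256) h² ≤ 256/(Kc₀)`
  have hquad : 2 * h - K * c₀ / 256 * h ^ 2 ≤ 256 / (K * c₀) := by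
    have hsq : 0 ≤ K * c₀ / 256 * (h - 256 / (K * c₀)) ^ 2 := by positivity
    have e : K * c₀ / 256 * (h - 256 / (K * c₀)) ^ 2 =
        K * c₀ / 256 * h ^ 2 - 2 * h + 256 / (K * c₀) := by
      field_simp
      ring
    linarith [hsq, e]
  have hmono : K * c₀ / 256 * h ^ 2 ≤ K * (c₀ / 4) * D := by
    have := mul_le_mul_of_nonneg_left h64 (show 0 ≤ K * c₀ / 256 by positivity)
    linarith
  linarith

/-! ### The envelope variance bound -/

/-- **Brascamp–Lieb on the log-concave envelope (pre-limit form of the core variance bound).**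
For a (U1)+(N)+(A ≤ B)+(C) table with a convexity radius `δ₀`, core threshold `2a = δ₀²`,
penalty strength `k ≥ 0` with `k·6a² ≥ 2max(B,0) + c₀/4`, stiffness `K > 0` and a torus with
`2 ≤ L ≤ M`: the weight `e^{-f}` of the envelope
`f = K·[Σ_s Re F((ext v)∘sh s) + k Σ_s p(ΣΣ((ext v)_{sh s w} − (ext v)_{sh s w'})² − a)]` and its
first two moments against `h = (ext v)(x,0) − (ext v)(y,0)` are integrable, and
`(∫h²e^{-f})(∫e^{-f}) − (∫he^{-f})² ≤ (256/(Kc₀))·(∫e^{-f})²` — `Var(h) ≤ 256/(Kc₀)` uniformly in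
`2 ≤ L ≤ M` and in `k`.  On the core `{∀ s, ΣΣ(…)² ≤ a}` the envelope is `K·Re A(ext v)` itself.
[cite: BrascampLieb1976, Thm 4.1] -/
theorem coreEnvelope_variance (hr : 2 ≤ r) (c : Table r) (hU1 : ∀ n ∈ c.support, ∑ w, n w = 0)
    (hN : c.sum (fun _ a => a) = 0) {B c₀ : ℝ} (hc₀ : 0 < c₀) (hA : normA c ≤ B)
    (hC : ∀ φ : W r → ℝ, c₀ * ∑ w : W r, ∑ w' : W r, (1 - Real.cos (φ w - φ w')) ≤ (genF c φ).re)
    {δ₀ : ℝ} (hδ₀ : 0 < δ₀)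
    (hconv : ∀ φ : W r → ℝ, (∀ w w', |φ w - φ w'| ≤ δ₀) → ∀ ψ : W r → ℝ,
      c₀ / 4 * ∑ w : W r, ∑ w' : W r, (ψ w - ψ w') ^ 2 ≤
        (-c.sum (fun n b => b * (((∑ w, (n w : ℝ) * ψ w) ^ 2 : ℝ) : ℂ) *
          Complex.exp (Complex.I * ((∑ w, (n w : ℝ) * φ w : ℝ) : ℂ)))).re)
    {a k K : ℝ} (ha : 2 * a = δ₀ ^ 2) (hk0 : 0 ≤ k) (hk : 2 * max B 0 + c₀ / 4 ≤ k * (6 * a ^ 2))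
    (hK : 0 < K) (hL : 2 ≤ L) (hLM : L ≤ M) (x y : TorusSite 2 L) :
    let ext : ({i : Λ L M // i ≠ 0} → ℝ) → Λ L M → ℝ :=
      fun v i => if h : i = (0 : Λ L M) then (0 : ℝ) else v ⟨i, h⟩
    let f : ({i : Λ L M // i ≠ 0} → ℝ) → ℝ := fun v =>
      K * ((∑ s : Λ L M, (genF c (fun w => ext v (sh L M s w))).re) +
        k * ∑ s : Λ L M, (max ((∑ w : W r, ∑ w' : W r, (ext v (sh L M s w) - ext v (sh L M s w')) ^ 2) - a) 0) ^ 3)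
    let hobs : ({i : Λ L M // i ≠ 0} → ℝ) → ℝ := fun v => ext v (x, 0) - ext v (y, 0)
    Integrable (fun v => Real.exp (-f v)) ∧
    Integrable (fun v => hobs v * Real.exp (-f v)) ∧
    Integrable (fun v => hobs v ^ 2 * Real.exp (-f v)) ∧
    (∫ v, hobs v ^ 2 * Real.exp (-f v)) * (∫ v, Real.exp (-f v)) -
        (∫ v, hobs v * Real.exp (-f v)) ^ 2 ≤ 256 / (K * c₀) * (∫ v, Real.exp (-f v)) ^ 2 := by
  intro ext f hobs
  have ha0 : 0 ≤ a := by nlinarith [sq_nonneg δ₀]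
  -- the observable as a dot product
  set avec : {i : Λ L M // i ≠ 0} → ℝ := fun i =>
    (if i.1 = ((x, 0) : Λ L M) then (1 : ℝ) else 0) - (if i.1 = ((y, 0) : Λ L M) then (1 : ℝ) else 0)
    with havec
  have hdot : ∀ η, avec ⬝ᵥ η = hobs η := fun η => slice_obs_eq_dotProduct x y η
  -- the floor form
  set q : ({i : Λ L M // i ≠ 0} → ℝ) → ℝ := fun η =>
    K * (c₀ / 4) * ∑ s : Λ L M, ∑ w : W r, ∑ w' : W r, (ext η (sh L M s w) - ext η (sh L M s w')) ^ 2 with hq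
  have hf : ContDiff ℝ 2 f := contDiff_envelope c K k a
  have hline : ∀ x' η : {i : Λ L M // i ≠ 0} → ℝ, ∃ g : ℝ → ℝ, ∃ g'₀ : ℝ,
      (∀ s, HasDerivAt (fun t : ℝ => f (x' + t • η)) (g s) s) ∧ HasDerivAt g g'₀ 0 ∧ q η ≤ g'₀ := by
    intro x' η
    refine ⟨_, _, fun s => envelope_line_hasDerivAt c K k a x' η s,
      envelope_dline_hasDerivAt c K k a x' η 0, ?_⟩
    exact core_floor c hU1 hA hδ₀ hconv ha hk0 hk hK.le (ext x') (ext η)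
  have hqpos : ∀ η, η ≠ 0 → 0 < q η := fun η hη =>
    mul_pos (mul_pos hK (by positivity)) (core_form_pos hr η hη)
  have hmin : ∃ x₀, ∀ v, f x₀ ≤ f v := ⟨0, fun v => envelope_min c hN hc₀.le hC hK.le hk0 ha0 v⟩
  have hσ : ∀ η, 2 * (avec ⬝ᵥ η) - q η ≤ 256 / (K * c₀) := fun η => by
    rw [hdot]
    exact core_sigma hr hK hc₀ hL hLM x y (ext η)
  obtain ⟨hZ, hA', hB', hV⟩ := LinearBL.linearBL hf hline hqpos hmin avec hσ
  simp only [hdot] at hA' hB' hV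
  exact ⟨hZ, hA', hB', hV⟩

end CoreBL

end Summit.HubbardSuperconductivity.HubbardSuperconductivity.Theorems
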